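import Literature.Geometry.Lorentzian.BogovskiiKernelDeriv
import Literature.Geometry.Lorentzian.BogovskiiPointwise
import Literature.Geometry.Lorentzian.BogovskiiVectorL2Bound
import Literature.Analysis.Calculus.PointSingularityIBP
import Literature.Analysis.SingularIntegrals.SchurTest
import Mathlib.MeasureTheory.Group.LIntegral
import Mathlib.MeasureTheory.Constructions.BorelSpace.ContinuousLinearMap
import HarnessLib

/-!
# `S_η : L²(B̄_ρ) → Ḣ¹`: the gain of one derivative for the Bogovskiĭ-type operator

(trunk G08 = T-LORENTZ; family `gr`; namespace `Literature.Geometry.Lorentzian.MaoOhTao`.)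

Mao–Oh–Tao (arXiv:2308.13031), Lemma 2.3 (S3): `S(χ_Ω ·) : H^{s'} → H^{s'+2}`.  `BogovskiiL2Bound.lean` proved the
order-`0` part; this file proves the **gain of one derivative at the `L²` level**:

* `hasFDerivAt_Q_diag`, `hasFDerivAt_kernel_section` — the `y`-derivative of the kernel section
  `u(y) = Ψ_η(x, y) = (x − y)ᵢ(x − y)ⱼ Q_y(x − y)` at `y ≠ x`: `∂_{y_m}u = −(D_zΨ)(x − y; y)(e_m) + Ψ_{∂_mη}(x, y)`;
* `pd_bogovskiiS_eq_integral_kernelDeriv` — **`∂_m (S_η f)(x) = ∫ (D_zΨ_η)(x − y; y)(e_m) f(y) dy`** for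
  `η, f ∈ C¹_c`: from `∂_m S_η f = S_{∂_mη} f + S_η ∂_m f` (`BogovskiiOperatorRegularity.lean`) by an integration by
  parts in `y` against the kernel section, which has an integrable point singularity at `y = x`
  (`Literature.Analysis.Calculus.integral_mul_fderiv_eq_neg_fderiv_mul_of_point_singularity`);
* `exists_h1Const_bogovskiiS` — **`∫ |∂_m (S_η f)^{ij}|² ≤ C ∫ |f|²`** for `f ∈ C¹_c(B̄_ρ)`, by Schur's test
  (`Literature.Analysis.SingularIntegrals`) on the kernel derivative, `‖D_zΨ_η(z; y)‖ ≤ C/|z|² 𝟙_{|z| ≤ R+ρ}`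
  (`BogovskiiKernelDeriv.lean`).

The second derivative (the full (S3)) is a Calderón–Zygmund singular integral (`|D²_zΨ| ~ |z|⁻³`, not integrable)
and is not treated here.

## References

* Y. Mao, S.-J. Oh, T. Tao, arXiv:2308.13031 (2023), Lemma 2.3 (S3), pp. 8–9 (key `MaoOhTao2023`).
-/

noncomputable section

open scoped RealInnerProductSpace Topology
open Filter MeasureTheory Set Metric Function

namespace Literature.Geometry.Lorentzian

namespace MaoOhTao

/-! ### The diagonal derivative of `Q`: `y ↦ Q_y(x − y)` -/

section H1

variable {η : E3 → ℝ} {R : ℝ}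

/-- **`y ↦ Q_y(x − y)` is differentiable at `y₀ ≠ x`**, with
`D = ∫_1^∞ ((1 − s) s²) • Dη(s(x − y₀) + y₀) ds` (`s(x − y) + y = sx + (1 − s)y`). [folklore] -/
theorem hasFDerivAt_Q_diag (hη : ContDiff ℝ 1 η) (hR : ∀ z : E3, R < ‖z‖ → η z = 0) (x : E3) {y₀ : E3}
    (hy₀ : y₀ ≠ x) :
    HasFDerivAt (fun y : E3 ↦ ∫ s in Ioi (1 : ℝ), η (s • (x - y) + y) * s ^ 2)
      (∫ s in Ioi (1 : ℝ), ((1 - s) * s ^ 2) • fderiv ℝ η (s • (x - y₀) + y₀)) y₀ := by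
  have hηc : Continuous η := hη.continuous
  have hdc : Continuous (fderiv ℝ η) := hη.continuous_fderiv one_ne_zero
  obtain ⟨M', hM'⟩ := hdc.bounded_above_of_compact_support ((HasCompactSupport.intro (isCompact_closedBall (0 : E3) R)
    fun z hz ↦ hR z (by rwa [mem_closedBall, dist_zero_right, not_le] at hz)).fderiv (𝕜 := ℝ))
  have hM'0 : 0 ≤ M' := (norm_nonneg _).trans (hM' 0)
  have hd₀ : 0 < ‖x - y₀‖ := norm_pos_iff.2 (sub_ne_zero.2 (Ne.symm hy₀))
  set r : ℝ := ‖x - y₀‖ / 2 with hr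
  have hr0 : 0 < r := by positivity
  set Y : ℝ := ‖y₀‖ + r with hY
  set S₀ : ℝ := max (R + Y) 0 / r with hS₀
  have hS₀0 : 0 ≤ S₀ := div_nonneg (le_max_right _ _) hr0.le
  have hzlow : ∀ y ∈ ball y₀ r, r ≤ ‖x - y‖ := by
    intro y hy
    rw [mem_ball, dist_eq_norm] at hy
    have : ‖x - y₀‖ ≤ ‖x - y‖ + ‖y - y₀‖ := by
      calc ‖x - y₀‖ = ‖(x - y) + (y - y₀)‖ := by rw [sub_add_sub_cancel]
        _ ≤ ‖x - y‖ + ‖y - y₀‖ := norm_add_le _ _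
    linarith
  have hYy : ∀ y ∈ ball y₀ r, ‖y‖ ≤ Y := by
    intro y hy
    rw [mem_ball, dist_eq_norm] at hy
    have := norm_le_insert' y y₀
    linarith
  have hvan : ∀ y ∈ ball y₀ r, ∀ s : ℝ, S₀ < |s| → R + ‖y‖ < |s| * ‖x - y‖ := by
    intro y hy s hs
    rw [hS₀, div_lt_iff₀ hr0] at hs
    calc R + ‖y‖ ≤ R + Y := by linarith [hYy y hy]
      _ ≤ max (R + Y) 0 := le_max_left _ _
      _ < |s| * r := hs
      _ ≤ |s| * ‖x - y‖ := mul_le_mul_of_nonneg_left (hzlow y hy) (abs_nonneg s)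
  set F : E3 → ℝ → ℝ := fun y s ↦ η (s • (x - y) + y) * s ^ 2 with hF
  set F' : E3 → ℝ → (E3 →L[ℝ] ℝ) := fun y s ↦ ((1 - s) * s ^ 2) • fderiv ℝ η (s • (x - y) + y) with hF'
  have hFc : ∀ y, Continuous (F y) := fun y ↦
    (hηc.comp (((continuous_id.smul continuous_const).add continuous_const))).mul (continuous_pow 2)
  have hF'c : ∀ y, Continuous (F' y) := fun y ↦
    ((continuous_const.sub continuous_id).mul (continuous_pow 2)).smul
      (hdc.comp ((continuous_id.smul continuous_const).add continuous_const))
  have hF_meas : ∀ᶠ y in 𝓝 y₀, AEStronglyMeasurable (F y) (volume.restrict (Ioi 1)) :=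
    Eventually.of_forall fun y ↦ (hFc y).aestronglyMeasurable
  have hF_int : Integrable (F y₀) (volume.restrict (Ioi 1)) := by
    refine ((hFc y₀).integrable_of_hasCompactSupport (HasCompactSupport.intro (isCompact_Icc (a := -S₀) (b := S₀))
      fun s hs ↦ ?_)).restrict
    have hs' : S₀ < |s| := by
      by_contra hle
      exact hs (abs_le.1 (not_lt.1 hle))
    show η (s • (x - y₀) + y₀) * s ^ 2 = 0
    rw [eta_ray_eq_zero hR (hvan y₀ (mem_ball_self hr0) s hs'), zero_mul]
  have hF'_meas : AEStronglyMeasurable (F' y₀) (volume.restrict (Ioi 1)) := (hF'c y₀).aestronglyMeasurable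
  have h_bound : ∀ᵐ s ∂(volume.restrict (Ioi 1)), ∀ y ∈ ball y₀ r, ‖F' y s‖ ≤
      (Icc (-S₀) S₀).indicator (fun _ ↦ (1 + S₀) * S₀ ^ 2 * M') s := by
    refine ae_of_all _ fun s y hy ↦ ?_
    by_cases hs : s ∈ Icc (-S₀) S₀
    · rw [indicator_of_mem hs, hF', norm_smul, Real.norm_eq_abs, abs_mul, abs_pow]
      have hs' : |s| ≤ S₀ := abs_le.2 ⟨hs.1, hs.2⟩
      have h1s : |1 - s| ≤ 1 + S₀ := by
        calc |1 - s| ≤ |1| + |s| := abs_sub _ _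
          _ ≤ 1 + S₀ := by rw [abs_one]; linarith
      exact mul_le_mul (mul_le_mul h1s (pow_le_pow_left₀ (abs_nonneg s) hs' 2) (by positivity) (by positivity))
        (hM' _) (norm_nonneg _) (by positivity)
    · rw [indicator_of_notMem hs]
      have hs' : S₀ < |s| := by
        by_contra hle
        exact hs (abs_le.1 (not_lt.1 hle))
      simp only [hF']
      rw [fderiv_eta_ray_eq_zero hR (hvan y hy s hs'), smul_zero, norm_zero]
  have hbi : Integrable (fun s : ℝ ↦ (Icc (-S₀) S₀).indicator (fun _ ↦ (1 + S₀) * S₀ ^ 2 * M') s)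
      (volume.restrict (Ioi 1)) :=
    ((integrable_indicator_iff measurableSet_Icc).2 continuous_const.integrableOn_Icc).restrict
  have h_diff : ∀ᵐ s ∂(volume.restrict (Ioi 1)), ∀ y ∈ ball y₀ r, HasFDerivAt (F · s) (F' y s) y := by
    refine ae_of_all _ fun s y _ ↦ ?_
    have h1 : HasFDerivAt (fun y : E3 ↦ s • (x - y) + y) ((1 - s) • ContinuousLinearMap.id ℝ E3) y := by
      have h := (((hasFDerivAt_const (𝕜 := ℝ) x y).sub (hasFDerivAt_id y)).const_smul s).add (hasFDerivAt_id y)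
      refine h.congr_fderiv ?_
      ext v
      simp
      ring
    have h2 : HasFDerivAt η (fderiv ℝ η (s • (x - y) + y)) (s • (x - y) + y) :=
      (hη.differentiable one_ne_zero _).hasFDerivAt
    have h3 := (HasFDerivAt.comp y (f := fun y : E3 ↦ s • (x - y) + y) h2 h1).mul_const (s ^ 2)
    have heq : (s ^ 2) • (fderiv ℝ η (s • (x - y) + y)).comp ((1 - s) • ContinuousLinearMap.id ℝ E3) = F' y s := by
      ext v
      simp [hF']
      ring
    rw [← heq]
    simpa only [Function.comp_def] using h3
  exact hasFDerivAt_integral_of_dominated_of_fderiv_le (ball_mem_nhds y₀ hr0) hF_meas hF_int hF'_meas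
    h_bound hbi h_diff

/-- The diagonal derivative splits: `∫ ((1 − s)s²) • Dη = ∫ s² • Dη − ∫ s³ • Dη` (base-point derivative minus
`z`-derivative of `Q`). [folklore] -/
theorem integral_diag_split (hη : ContDiff ℝ 1 η) (hR : ∀ z : E3, R < ‖z‖ → η z = 0) (y : E3) {z : E3}
    (hz : z ≠ 0) :
    ∫ s in Ioi (1 : ℝ), ((1 - s) * s ^ 2) • fderiv ℝ η (s • z + y) =
      (∫ s in Ioi (1 : ℝ), (s ^ 2) • fderiv ℝ η (s • z + y)) - ∫ s in Ioi (1 : ℝ), (s ^ 3) • fderiv ℝ η (s • z + y) := by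
  have hdc : Continuous (fderiv ℝ η) := hη.continuous_fderiv one_ne_zero
  have hn : 0 < ‖z‖ := norm_pos_iff.2 hz
  -- both integrands have compact support in `s`
  have hcs : ∀ k : ℕ, Integrable (fun s : ℝ ↦ (s ^ k) • fderiv ℝ η (s • z + y)) (volume.restrict (Ioi 1)) := by
    intro k
    refine (((continuous_pow k).smul (hdc.comp ((continuous_id.smul continuous_const).add
      continuous_const))).integrable_of_hasCompactSupport (HasCompactSupport.intro
        (isCompact_Icc (a := -(max (R + ‖y‖) 0 / ‖z‖)) (b := max (R + ‖y‖) 0 / ‖z‖)) fun s hs ↦ ?_)).restrict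
    have hs' : max (R + ‖y‖) 0 / ‖z‖ < |s| := by
      by_contra hle
      exact hs (abs_le.1 (not_lt.1 hle))
    show (s ^ k) • fderiv ℝ η (s • z + y) = 0
    rw [fderiv_eta_ray_eq_zero hR (lt_abs_mul_norm_of_lt hz hs'), smul_zero]
  rw [← integral_sub (hcs 2) (hcs 3)]
  refine integral_congr_ae (ae_of_all _ fun s ↦ ?_)
  simp only [← sub_smul]
  congr 1
  ring

/-- The base-point derivative of `Q` evaluated on `e_m` is `Q` for the cut-off `∂_mη`:
`(∫ s² • Dη(sz + y))(e_m) = ∫ ∂_mη(sz + y) s² ds`. [folklore] -/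
theorem integral_sq_smul_fderiv_apply_e (hη : ContDiff ℝ 1 η) (hR : ∀ z : E3, R < ‖z‖ → η z = 0) (y : E3)
    {z : E3} (hz : z ≠ 0) (m : Fin 3) :
    (∫ s in Ioi (1 : ℝ), (s ^ 2) • fderiv ℝ η (s • z + y)) (e m) = ∫ s in Ioi (1 : ℝ), pd m η (s • z + y) * s ^ 2 := by
  have hdc : Continuous (fderiv ℝ η) := hη.continuous_fderiv one_ne_zero
  have hn : 0 < ‖z‖ := norm_pos_iff.2 hz
  have hint : Integrable (fun s : ℝ ↦ (s ^ 2) • fderiv ℝ η (s • z + y)) (volume.restrict (Ioi 1)) := by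
    refine (((continuous_pow 2).smul (hdc.comp ((continuous_id.smul continuous_const).add
      continuous_const))).integrable_of_hasCompactSupport (HasCompactSupport.intro
        (isCompact_Icc (a := -(max (R + ‖y‖) 0 / ‖z‖)) (b := max (R + ‖y‖) 0 / ‖z‖)) fun s hs ↦ ?_)).restrict
    have hs' : max (R + ‖y‖) 0 / ‖z‖ < |s| := by
      by_contra hle
      exact hs (abs_le.1 (not_lt.1 hle))
    show (s ^ 2) • fderiv ℝ η (s • z + y) = 0
    rw [fderiv_eta_ray_eq_zero hR (lt_abs_mul_norm_of_lt hz hs'), smul_zero]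
  rw [ContinuousLinearMap.integral_apply hint (e m)]
  refine integral_congr_ae (ae_of_all _ fun s ↦ ?_)
  simp only [FunLike.coe_smul, Pi.smul_apply, smul_eq_mul, pd]
  ring

/-- **The `y`-derivative of the kernel section `u(y) = Ψ_η(x, y) = (x−y)ᵢ(x−y)ⱼ Q_y(x − y)`** at `y ≠ x`, evaluated on
`e_m`: `∂_{y_m} u = −(D_zΨ)(x − y; y)(e_m) + Ψ_{∂_mη}(x, y)` (the derivative through `z = x − y` plus the derivative
through the base point, the latter being the kernel of `S_{∂_mη}`). [folklore] -/
theorem hasFDerivAt_kernel_section (hη : ContDiff ℝ 1 η) (hR : ∀ z : E3, R < ‖z‖ → η z = 0) (x : E3) {y : E3}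
    (hy : y ≠ x) (i j : Fin 3) :
    ∃ L : E3 →L[ℝ] ℝ, HasFDerivAt (fun y : E3 ↦ (x - y) i * (x - y) j *
        ∫ s in Ioi (1 : ℝ), η (s • (x - y) + y) * s ^ 2) L y ∧
      ∀ m : Fin 3, L (e m) =
        -(((x - y) i * (x - y) j) • (∫ s in Ioi (1 : ℝ), (s ^ 3) • fderiv ℝ η (s • (x - y) + y)) +
            (∫ s in Ioi (1 : ℝ), η (s • (x - y) + y) * s ^ 2) •
              ((x - y) i • EuclideanSpace.proj (𝕜 := ℝ) j + (x - y) j • EuclideanSpace.proj (𝕜 := ℝ) i))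
            (e m) +
          (x - y) i * (x - y) j * ∫ s in Ioi (1 : ℝ), pd m η (s • (x - y) + y) * s ^ 2 := by
  have hz : x - y ≠ 0 := sub_ne_zero.2 (Ne.symm hy)
  have hpi : HasFDerivAt (fun y : E3 ↦ (x - y) i) (-(EuclideanSpace.proj (𝕜 := ℝ) i)) y := by
    have h := ((hasFDerivAt_const (𝕜 := ℝ) x y).sub (hasFDerivAt_id y))
    have h2 : HasFDerivAt (fun y : E3 ↦ (x - y) i) ((EuclideanSpace.proj (𝕜 := ℝ) i).comp (0 - ContinuousLinearMap.id ℝ E3)) y :=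
      (EuclideanSpace.proj (𝕜 := ℝ) i).hasFDerivAt.comp y h
    convert h2 using 1
    ext v
    simp
  have hpj : HasFDerivAt (fun y : E3 ↦ (x - y) j) (-(EuclideanSpace.proj (𝕜 := ℝ) j)) y := by
    have h := ((hasFDerivAt_const (𝕜 := ℝ) x y).sub (hasFDerivAt_id y))
    have h2 : HasFDerivAt (fun y : E3 ↦ (x - y) j) ((EuclideanSpace.proj (𝕜 := ℝ) j).comp (0 - ContinuousLinearMap.id ℝ E3)) y :=
      (EuclideanSpace.proj (𝕜 := ℝ) j).hasFDerivAt.comp y h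
    convert h2 using 1
    ext v
    simp
  have hQ := hasFDerivAt_Q_diag hη hR x hy
  refine ⟨_, (hpi.mul hpj).mul hQ, fun m ↦ ?_⟩
  rw [integral_diag_split hη hR y hz]
  simp [integral_sq_smul_fderiv_apply_e hη hR y hz m]
  ring

end H1

section H1B

variable {η : E3 → ℝ} {R : ℝ}

/-- A function continuous off one point of `ℝ³` is a.e.-strongly measurable. [folklore] -/
theorem aestronglyMeasurable_of_continuousOn_compl_singleton' {X : Type*} [TopologicalSpace X]
    [TopologicalSpace.PseudoMetrizableSpace X] {g : E3 → X} {a : E3} (hg : ContinuousOn g {a}ᶜ) :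
    AEStronglyMeasurable g (volume : Measure E3) := by
  have h := hg.aestronglyMeasurable (μ := (volume : Measure E3)) (measurableSet_singleton a).compl
  rwa [restrict_compl_singleton] at h

/-- Joint strong measurability of the classical factor `(x, y) ↦ Q_y(x − y)` and of its `z`-derivative integral
`(x, y) ↦ ∫_1^∞ s³ • Dη(s(x − y) + y)`. [folklore] -/
theorem stronglyMeasurable_Q_prod (hη : Continuous η) :
    StronglyMeasurable fun p : E3 × E3 ↦ ∫ s in Ioi (1 : ℝ), η (s • (p.1 - p.2) + p.2) * s ^ 2 := by
  have hsub : Continuous fun p : E3 × E3 ↦ p.1 - p.2 := continuous_fst.sub continuous_snd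
  have hc : Continuous fun q : (E3 × E3) × ℝ ↦ η (q.2 • (q.1.1 - q.1.2) + q.1.2) * q.2 ^ 2 :=
    (hη.comp ((continuous_snd.smul (hsub.comp continuous_fst)).add (continuous_snd.comp continuous_fst))).mul
      (continuous_snd.pow 2)
  exact hc.stronglyMeasurable.integral_prod_right' (ν := (volume : Measure ℝ).restrict (Ioi 1))

/-- Joint strong measurability of `(x, y) ↦ ∫_1^∞ s³ • Dη(s(x − y) + y)`. [folklore] -/
theorem stronglyMeasurable_DQ_prod (hη : ContDiff ℝ 1 η) :
    StronglyMeasurable fun p : E3 × E3 ↦ ∫ s in Ioi (1 : ℝ), (s ^ 3) • fderiv ℝ η (s • (p.1 - p.2) + p.2) := by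
  have hdc : Continuous (fderiv ℝ η) := hη.continuous_fderiv one_ne_zero
  have hsub : Continuous fun p : E3 × E3 ↦ p.1 - p.2 := continuous_fst.sub continuous_snd
  have hc : Continuous fun q : (E3 × E3) × ℝ ↦ (q.2 ^ 3) • fderiv ℝ η (q.2 • (q.1.1 - q.1.2) + q.1.2) :=
    (continuous_snd.pow 3).smul (hdc.comp ((continuous_snd.smul (hsub.comp continuous_fst)).add
      (continuous_snd.comp continuous_fst)))
  exact hc.stronglyMeasurable.integral_prod_right' (ν := (volume : Measure ℝ).restrict (Ioi 1))

/-- Joint strong measurability of the kernel derivative `(x, y) ↦ D_zΨ(x − y; y)`. [folklore] -/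
theorem stronglyMeasurable_DK_prod (hη : ContDiff ℝ 1 η) (i j : Fin 3) :
    StronglyMeasurable fun p : E3 × E3 ↦
      ((p.1 - p.2) i * (p.1 - p.2) j) • (∫ s in Ioi (1 : ℝ), (s ^ 3) • fderiv ℝ η (s • (p.1 - p.2) + p.2)) +
        (∫ s in Ioi (1 : ℝ), η (s • (p.1 - p.2) + p.2) * s ^ 2) •
          ((p.1 - p.2) i • EuclideanSpace.proj (𝕜 := ℝ) j + (p.1 - p.2) j • EuclideanSpace.proj (𝕜 := ℝ) i) := by
  have hsub : Continuous fun p : E3 × E3 ↦ p.1 - p.2 := continuous_fst.sub continuous_snd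
  have hci : Continuous fun p : E3 × E3 ↦ (p.1 - p.2) i := (EuclideanSpace.proj (𝕜 := ℝ) i).continuous.comp hsub
  have hcj : Continuous fun p : E3 × E3 ↦ (p.1 - p.2) j := (EuclideanSpace.proj (𝕜 := ℝ) j).continuous.comp hsub
  refine ((hci.mul hcj).stronglyMeasurable.smul (stronglyMeasurable_DQ_prod hη)).add
    ((stronglyMeasurable_Q_prod hη.continuous).smul ?_)
  exact ((hci.smul continuous_const).add (hcj.smul continuous_const)).stronglyMeasurable

/-- The `y`-section of the `S_η` integrand, in classical form, is integrable (continuous compactly supported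
density `g`). [folklore] -/
theorem integrable_classical_section (hη : Continuous η) (hR : ∀ z : E3, R < ‖z‖ → η z = 0) {g : E3 → ℝ}
    (hg : Continuous g) (hgc : HasCompactSupport g) (x : E3) (i j : Fin 3) :
    Integrable fun y : E3 ↦ ((x - y) i * (x - y) j * ∫ s in Ioi (1 : ℝ), η (s • (x - y) + y) * s ^ 2) * g y := by
  have h := (integrable_translated hη hR hg hgc x i j).comp_sub_left x
  refine h.congr (ae_of_all _ fun y ↦ ?_)
  show bogovskiiWeight η (x - (x - y)) ‖x - y‖ (‖x - y‖⁻¹ • (x - y)) * ((x - y) i * ((x - y) j * (‖x - y‖ ^ 3)⁻¹)) *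
      g (x - (x - y)) = ((x - y) i * (x - y) j * ∫ s in Ioi (1 : ℝ), η (s • (x - y) + y) * s ^ 2) * g y
  rw [sub_sub_cancel, bogovskiiKernel_eq_classical η y (x - y) i j]

/-- The `y`-sections of `Q` and of its `z`-derivative integral are strongly measurable. [folklore] -/
theorem stronglyMeasurable_Q_section (hη : Continuous η) (x : E3) :
    StronglyMeasurable fun y : E3 ↦ ∫ s in Ioi (1 : ℝ), η (s • (x - y) + y) * s ^ 2 := by
  have hc : Continuous fun q : E3 × ℝ ↦ η (q.2 • (x - q.1) + q.1) * q.2 ^ 2 :=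
    (hη.comp ((continuous_snd.smul (continuous_const.sub continuous_fst)).add continuous_fst)).mul
      (continuous_snd.pow 2)
  exact hc.stronglyMeasurable.integral_prod_right' (ν := (volume : Measure ℝ).restrict (Ioi 1))

/-- The `y`-section of the `z`-derivative integral is strongly measurable. [folklore] -/
theorem stronglyMeasurable_DQ_section (hη : ContDiff ℝ 1 η) (x : E3) :
    StronglyMeasurable fun y : E3 ↦ ∫ s in Ioi (1 : ℝ), (s ^ 3) • fderiv ℝ η (s • (x - y) + y) := by
  have hdc : Continuous (fderiv ℝ η) := hη.continuous_fderiv one_ne_zero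
  have hc : Continuous fun q : E3 × ℝ ↦ (q.2 ^ 3) • fderiv ℝ η (q.2 • (x - q.1) + q.1) :=
    (continuous_snd.pow 3).smul (hdc.comp ((continuous_snd.smul (continuous_const.sub continuous_fst)).add
      continuous_fst))
  exact hc.stronglyMeasurable.integral_prod_right' (ν := (volume : Measure ℝ).restrict (Ioi 1))

/-- The `y`-section `y ↦ D_zΨ(x − y; y)` of the kernel derivative is strongly measurable. [folklore] -/
theorem stronglyMeasurable_DK_section (hη : ContDiff ℝ 1 η) (i j : Fin 3) (x : E3) :
    StronglyMeasurable fun y : E3 ↦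
      (((x - y) i * (x - y) j) • (∫ s in Ioi (1 : ℝ), (s ^ 3) • fderiv ℝ η (s • (x - y) + y)) +
        (∫ s in Ioi (1 : ℝ), η (s • (x - y) + y) * s ^ 2) •
          ((x - y) i • EuclideanSpace.proj (𝕜 := ℝ) j + (x - y) j • EuclideanSpace.proj (𝕜 := ℝ) i)) := by
  have hsub : Continuous fun y : E3 ↦ x - y := continuous_const.sub continuous_id
  have hci : Continuous fun y : E3 ↦ (x - y) i := (EuclideanSpace.proj (𝕜 := ℝ) i).continuous.comp hsub
  have hcj : Continuous fun y : E3 ↦ (x - y) j := (EuclideanSpace.proj (𝕜 := ℝ) j).continuous.comp hsub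
  refine ((hci.mul hcj).stronglyMeasurable.smul (stronglyMeasurable_DQ_section hη x)).add
    ((stronglyMeasurable_Q_section hη.continuous x).smul ?_)
  exact ((hci.smul continuous_const).add (hcj.smul continuous_const)).stronglyMeasurable

/-- `|L e_m| ≤ ‖L‖` for a functional on `ℝ³`. [folklore] -/
theorem abs_apply_e_le_opNorm (L : E3 →L[ℝ] ℝ) (m : Fin 3) : |L (e m)| ≤ ‖L‖ := by
  have hem : ‖(e m : E3)‖ = 1 := by simp [e, PiLp.norm_single]
  rw [← Real.norm_eq_abs]
  calc ‖L (e m)‖ ≤ ‖L‖ * ‖(e m : E3)‖ := L.le_opNorm _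
    _ = ‖L‖ := by rw [hem, mul_one]

/-- **Integrability of `y ↦ D_zΨ(x − y; y)(e_m) f(y)`** for continuous compactly supported `f` (the singularity is
`|x − y|⁻²`). [folklore] -/
theorem integrable_DK_apply_mul (hη : ContDiff ℝ 1 η) (hR : ∀ z : E3, R < ‖z‖ → η z = 0) {f : E3 → ℝ}
    (hf : Continuous f) (hfc : HasCompactSupport f) (i j m : Fin 3) (x : E3) :
    Integrable fun y : E3 ↦
      (((x - y) i * (x - y) j) • (∫ s in Ioi (1 : ℝ), (s ^ 3) • fderiv ℝ η (s • (x - y) + y)) +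
        (∫ s in Ioi (1 : ℝ), η (s • (x - y) + y) * s ^ 2) •
          ((x - y) i • EuclideanSpace.proj (𝕜 := ℝ) j + (x - y) j • EuclideanSpace.proj (𝕜 := ℝ) i)) (e m) * f y := by
  have hηc : Continuous η := hη.continuous
  obtain ⟨Rf, Mf, hfR, -, hfM⟩ := exists_radius_bound hf hfc
  obtain ⟨M, hM⟩ := hηc.bounded_above_of_compact_support (HasCompactSupport.intro (isCompact_closedBall (0 : E3) R)
    fun z hz ↦ hR z (by rwa [mem_closedBall, dist_zero_right, not_le] at hz))
  obtain ⟨M', hM'⟩ := (hη.continuous_fderiv one_ne_zero).bounded_above_of_compact_support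
    ((HasCompactSupport.intro (isCompact_closedBall (0 : E3) R)
      fun z hz ↦ hR z (by rwa [mem_closedBall, dist_zero_right, not_le] at hz)).fderiv (𝕜 := ℝ))
  have hMabs : ∀ w, |η w| ≤ M := fun w ↦ by rw [← Real.norm_eq_abs]; exact hM w
  have hMf0 : 0 ≤ Mf := (abs_nonneg _).trans (hfM 0)
  have hM0 : 0 ≤ M := (abs_nonneg _).trans (hMabs 0)
  have hM'0 : 0 ≤ M' := (norm_nonneg _).trans (hM' 0)
  set ρ : ℝ := max Rf (-R) with hρ
  have hRρ : 0 ≤ R + ρ := by rw [hρ]; have := le_max_right Rf (-R); linarith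
  have hfρ : ∀ y, f y ≠ 0 → ‖y‖ ≤ ρ := fun y hy ↦ (hfR y hy).trans (le_max_left _ _)
  have hmeas : AEStronglyMeasurable (fun y : E3 ↦
      (((x - y) i * (x - y) j) • (∫ s in Ioi (1 : ℝ), (s ^ 3) • fderiv ℝ η (s • (x - y) + y)) +
        (∫ s in Ioi (1 : ℝ), η (s • (x - y) + y) * s ^ 2) •
          ((x - y) i • EuclideanSpace.proj (𝕜 := ℝ) j + (x - y) j • EuclideanSpace.proj (𝕜 := ℝ) i)) (e m) * f y)
      volume :=
    ((ContinuousLinearMap.measurable_apply (e m)).comp_aemeasurable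
      (stronglyMeasurable_DK_section hη i j x).measurable.aemeasurable).aestronglyMeasurable.mul hf.aestronglyMeasurable
  refine ((integrable_indicator_inv_norm_sq ((4 * M * (R + ρ) ^ 3 + 2 * M' * (R + ρ) ^ 4) * Mf) (R + ρ)).comp_sub_left
    x).mono' hmeas (ae_of_all _ fun y ↦ ?_)
  have hind0 : 0 ≤ (closedBall (0 : E3) (R + ρ)).indicator
      (fun z ↦ (4 * M * (R + ρ) ^ 3 + 2 * M' * (R + ρ) ^ 4) * Mf * (‖z‖ ^ 2)⁻¹) (x - y) :=
    indicator_nonneg (fun z _ ↦ by positivity) _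
  rw [norm_mul, Real.norm_eq_abs, Real.norm_eq_abs]
  by_cases hfy : f y = 0
  · rw [hfy, abs_zero, mul_zero]; exact hind0
  have hy : ‖y‖ ≤ ρ := hfρ y hfy
  by_cases hz : x - y = 0
  · have h0 : (((x - y) i * (x - y) j) • (∫ s in Ioi (1 : ℝ), (s ^ 3) • fderiv ℝ η (s • (x - y) + y)) +
        (∫ s in Ioi (1 : ℝ), η (s • (x - y) + y) * s ^ 2) •
          ((x - y) i • EuclideanSpace.proj (𝕜 := ℝ) j + (x - y) j • EuclideanSpace.proj (𝕜 := ℝ) i)) (e m) = 0 := by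
      have hzi : (x - y) i = 0 := by rw [hz]; rfl
      have hzj : (x - y) j = 0 := by rw [hz]; rfl
      simp [hzi, hzj]
    rw [h0, abs_zero, zero_mul]; exact hind0
  have hbd := norm_fderiv_classicalKernel_le hη hR hMabs hM' hRρ hy hz i j
  calc |(((x - y) i * (x - y) j) • (∫ s in Ioi (1 : ℝ), (s ^ 3) • fderiv ℝ η (s • (x - y) + y)) +
        (∫ s in Ioi (1 : ℝ), η (s • (x - y) + y) * s ^ 2) •
          ((x - y) i • EuclideanSpace.proj (𝕜 := ℝ) j + (x - y) j • EuclideanSpace.proj (𝕜 := ℝ) i)) (e m)| * |f y|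
      ≤ (closedBall (0 : E3) (R + ρ)).indicator
          (fun z ↦ (4 * M * (R + ρ) ^ 3 + 2 * M' * (R + ρ) ^ 4) * (‖z‖ ^ 2)⁻¹) (x - y) * Mf :=
        mul_le_mul ((abs_apply_e_le_opNorm _ m).trans hbd) (hfM y) (abs_nonneg _) (indicator_nonneg (fun z _ ↦ by
          positivity) _)
    _ = (closedBall (0 : E3) (R + ρ)).indicator
          (fun z ↦ (4 * M * (R + ρ) ^ 3 + 2 * M' * (R + ρ) ^ 4) * Mf * (‖z‖ ^ 2)⁻¹) (x - y) := by
        simp only [indicator]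
        split_ifs <;> ring

/-- **The `x`-derivative of `S_η f` through the kernel** (`η, f ∈ C¹_c`):
`∂_m (S_η f)^{ij}(x) = ∫ (D_zΨ_η)(x − y; y)(e_m) f(y) dy`, the derivative of the kernel at fixed base point `y`
(an integrable `|x − y|⁻²` singularity).  Proof: `∂_m S_η f = S_{∂_mη} f + S_η ∂_m f`; in the second term integrate by
parts in `y` against the kernel section (`PointSingularityIBP`), whose `y`-derivative is `−D_zΨ(e_m) + Ψ_{∂_mη}`.
[cite: MaoOhTao2023, Lemma 2.3 (S3)] -/
theorem pd_bogovskiiS_eq_integral_kernelDeriv (hη : ContDiff ℝ 1 η) (hR : ∀ z : E3, R < ‖z‖ → η z = 0)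
    {f : E3 → ℝ} (hf : ContDiff ℝ 1 f) (hfc : HasCompactSupport f) (i j m : Fin 3) (x : E3) :
    pd m (bogovskiiS η f i j) x = ∫ y : E3,
      (((x - y) i * (x - y) j) • (∫ s in Ioi (1 : ℝ), (s ^ 3) • fderiv ℝ η (s • (x - y) + y)) +
        (∫ s in Ioi (1 : ℝ), η (s • (x - y) + y) * s ^ 2) •
          ((x - y) i • EuclideanSpace.proj (𝕜 := ℝ) j + (x - y) j • EuclideanSpace.proj (𝕜 := ℝ) i)) (e m) * f y := by
  have hηc : Continuous η := hη.continuous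
  have hfcn : Continuous f := hf.continuous
  have hpdf : Continuous (pd m f) := by
    unfold pd; exact (hf.continuous_fderiv one_ne_zero).clm_apply continuous_const
  have hpdfc : HasCompactSupport (pd m f) := hasCompactSupport_pd hfc m
  have hpdη : Continuous (pd m η) := continuous_pd_eta hη m
  have hpdηR : ∀ z : E3, R < ‖z‖ → pd m η z = 0 := pd_eta_admissible hR m
  -- the two operators in classical form
  have hS1 : bogovskiiS (pd m η) f i j x =
      ∫ y, ((x - y) i * (x - y) j * ∫ s in Ioi (1 : ℝ), pd m η (s • (x - y) + y) * s ^ 2) * f y := by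
    rw [bogovskiiS_apply]
    refine integral_congr_ae (ae_of_all _ fun y ↦ ?_)
    show bogovskiiWeight (pd m η) y ‖x - y‖ (‖x - y‖⁻¹ • (x - y)) * ((x - y) i * ((x - y) j * (‖x - y‖ ^ 3)⁻¹)) * f y
      = ((x - y) i * (x - y) j * ∫ s in Ioi (1 : ℝ), pd m η (s • (x - y) + y) * s ^ 2) * f y
    rw [bogovskiiKernel_eq_classical (pd m η) y (x - y) i j]
  have hS2 : bogovskiiS η (pd m f) i j x =
      ∫ y, ((x - y) i * (x - y) j * ∫ s in Ioi (1 : ℝ), η (s • (x - y) + y) * s ^ 2) *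
        fderiv ℝ f y (EuclideanSpace.single m 1) := by
    rw [bogovskiiS_apply]
    refine integral_congr_ae (ae_of_all _ fun y ↦ ?_)
    show bogovskiiWeight η y ‖x - y‖ (‖x - y‖⁻¹ • (x - y)) * ((x - y) i * ((x - y) j * (‖x - y‖ ^ 3)⁻¹)) * pd m f y
      = ((x - y) i * (x - y) j * ∫ s in Ioi (1 : ℝ), η (s • (x - y) + y) * s ^ 2) *
        fderiv ℝ f y (EuclideanSpace.single m 1)
    rw [bogovskiiKernel_eq_classical η y (x - y) i j]
    rfl
  -- derivative of the kernel section off `y = x`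
  have hderiv : ∀ y, y ≠ x →
      DifferentiableAt ℝ (fun y : E3 ↦ (x - y) i * (x - y) j * ∫ s in Ioi (1 : ℝ), η (s • (x - y) + y) * s ^ 2) y ∧
      fderiv ℝ (fun y : E3 ↦ (x - y) i * (x - y) j * ∫ s in Ioi (1 : ℝ), η (s • (x - y) + y) * s ^ 2) y (e m) =
        -((((x - y) i * (x - y) j) • (∫ s in Ioi (1 : ℝ), (s ^ 3) • fderiv ℝ η (s • (x - y) + y)) +
            (∫ s in Ioi (1 : ℝ), η (s • (x - y) + y) * s ^ 2) •
              ((x - y) i • EuclideanSpace.proj (𝕜 := ℝ) j + (x - y) j • EuclideanSpace.proj (𝕜 := ℝ) i)) (e m)) +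
          (x - y) i * (x - y) j * ∫ s in Ioi (1 : ℝ), pd m η (s • (x - y) + y) * s ^ 2 := by
    intro y hy
    obtain ⟨L, hL, hLm⟩ := hasFDerivAt_kernel_section hη hR x hy i j
    exact ⟨hL.differentiableAt, by rw [hL.fderiv, hLm m]⟩
  -- integrability
  have hI1 := integrable_classical_section hηc hR hpdf hpdfc x i j
  have hI1' := integrable_classical_section hpdη hpdηR hfcn hfc x i j
  have hDKf := integrable_DK_apply_mul hη hR hfcn hfc i j m x
  have hae : (fun y ↦ fderiv ℝ (fun y : E3 ↦ (x - y) i * (x - y) j * ∫ s in Ioi (1 : ℝ), η (s • (x - y) + y) * s ^ 2)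
      y (EuclideanSpace.single m 1) * f y) =ᵐ[volume] fun y ↦
      -((((x - y) i * (x - y) j) • (∫ s in Ioi (1 : ℝ), (s ^ 3) • fderiv ℝ η (s • (x - y) + y)) +
          (∫ s in Ioi (1 : ℝ), η (s • (x - y) + y) * s ^ 2) •
            ((x - y) i • EuclideanSpace.proj (𝕜 := ℝ) j + (x - y) j • EuclideanSpace.proj (𝕜 := ℝ) i)) (e m) * f y) +
        ((x - y) i * (x - y) j * ∫ s in Ioi (1 : ℝ), pd m η (s • (x - y) + y) * s ^ 2) * f y := by
    filter_upwards [compl_mem_ae_iff.2 (measure_singleton x)] with y hy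
    rw [show (EuclideanSpace.single m (1 : ℝ) : E3) = e m from rfl, (hderiv y hy).2]
    ring
  have hI2 : Integrable fun y ↦ fderiv ℝ (fun y : E3 ↦ (x - y) i * (x - y) j *
      ∫ s in Ioi (1 : ℝ), η (s • (x - y) + y) * s ^ 2) y (EuclideanSpace.single m 1) * f y :=
    (hDKf.neg.add hI1').congr hae.symm
  have hI1s : Integrable fun y ↦ ((x - y) i * (x - y) j * ∫ s in Ioi (1 : ℝ), η (s • (x - y) + y) * s ^ 2) *
      fderiv ℝ f y (EuclideanSpace.single m 1) := hI1
  -- integration by parts with the point singularity at `y = x`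
  have hIBP := Literature.Analysis.Calculus.integral_mul_fderiv_eq_neg_fderiv_mul_of_point_singularity (n := 1) m
    (a := x) (fun y hy ↦ (hderiv y hy).1) hf hfc hI1s hI2
  -- assemble
  have hDKfn : Integrable fun y ↦
      -((((x - y) i * (x - y) j) • (∫ s in Ioi (1 : ℝ), (s ^ 3) • fderiv ℝ η (s • (x - y) + y)) +
          (∫ s in Ioi (1 : ℝ), η (s • (x - y) + y) * s ^ 2) •
            ((x - y) i • EuclideanSpace.proj (𝕜 := ℝ) j + (x - y) j • EuclideanSpace.proj (𝕜 := ℝ) i)) (e m) * f y) :=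
    hDKf.neg
  rw [pd_bogovskiiS hη hR hf hfc i j m]
  simp only
  rw [hS1, hS2, hIBP, integral_congr_ae hae, integral_add hDKfn hI1', integral_neg]
  ring

end H1B

section H1C

open scoped ENNReal

variable {η : E3 → ℝ} {R : ℝ}

/-- **`S_η : L²(B̄_ρ) → Ḣ¹`** (gain of one derivative at the `L²` level, by Schur's test on the kernel derivative
`|D_xΨ_η(x, y)| ≲ |x − y|⁻²`): for `η ∈ C¹_c` vanishing off `B̄_R` and `R + ρ ≥ 0` there is `C < ∞` with
`∫ |∂_m (S_η f)^{ij}|² ≤ C ∫ |f|²` for all `f ∈ C¹_c` supported in `B̄_ρ` and all `i, j, m`.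
[cite: MaoOhTao2023, Lemma 2.3 (S3)] -/
theorem exists_h1Const_bogovskiiS (hη : ContDiff ℝ 1 η) (hR : ∀ z : E3, R < ‖z‖ → η z = 0) {ρ : ℝ}
    (hRρ : 0 ≤ R + ρ) :
    ∃ C : ℝ≥0∞, C < ⊤ ∧ ∀ (f : E3 → ℝ), ContDiff ℝ 1 f → HasCompactSupport f → (∀ y, f y ≠ 0 → ‖y‖ ≤ ρ) →
      ∀ i j m : Fin 3, ∫⁻ x : E3, ‖pd m (bogovskiiS η f i j) x‖ₑ ^ (2 : ℝ) ≤ C * ∫⁻ y : E3, ‖f y‖ₑ ^ (2 : ℝ) := by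
  have hηc : Continuous η := hη.continuous
  obtain ⟨M, hM⟩ := hηc.bounded_above_of_compact_support (HasCompactSupport.intro (isCompact_closedBall (0 : E3) R)
    fun z hz ↦ hR z (by rwa [mem_closedBall, dist_zero_right, not_le] at hz))
  obtain ⟨M', hM'⟩ := (hη.continuous_fderiv one_ne_zero).bounded_above_of_compact_support
    ((HasCompactSupport.intro (isCompact_closedBall (0 : E3) R)
      fun z hz ↦ hR z (by rwa [mem_closedBall, dist_zero_right, not_le] at hz)).fderiv (𝕜 := ℝ))
  have hMabs : ∀ w, |η w| ≤ M := fun w ↦ by rw [← Real.norm_eq_abs]; exact hM w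
  set Cst : ℝ := 4 * M * (R + ρ) ^ 3 + 2 * M' * (R + ρ) ^ 4 with hCst
  set k : E3 → ℝ≥0∞ := fun z ↦ ENNReal.ofReal ((closedBall (0 : E3) (R + ρ)).indicator (fun z ↦ Cst * (‖z‖ ^ 2)⁻¹) z)
    with hk
  set Ck : ℝ≥0∞ := ∫⁻ z : E3, k z with hCk
  have hCk_top : Ck < ⊤ := lintegral_vmajorant_lt_top _ _
  refine ⟨Ck ^ ((2 : ℝ) / 2) * Ck, ENNReal.mul_lt_top (ENNReal.rpow_lt_top_of_nonneg (by norm_num) hCk_top.ne)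
    hCk_top, fun f hf hfc hfρ i j m ↦ ?_⟩
  -- the Schur kernel `‖D_zΨ(x − y; y)‖ 𝟙_{|y| ≤ ρ}`
  set DK : E3 × E3 → (E3 →L[ℝ] ℝ) := fun p ↦
      ((p.1 - p.2) i * (p.1 - p.2) j) • (∫ s in Ioi (1 : ℝ), (s ^ 3) • fderiv ℝ η (s • (p.1 - p.2) + p.2)) +
        (∫ s in Ioi (1 : ℝ), η (s • (p.1 - p.2) + p.2) * s ^ 2) •
          ((p.1 - p.2) i • EuclideanSpace.proj (𝕜 := ℝ) j + (p.1 - p.2) j • EuclideanSpace.proj (𝕜 := ℝ) i) with hDK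
  have hDKm : StronglyMeasurable DK := stronglyMeasurable_DK_prod hη i j
  set K : E3 → E3 → ℝ≥0∞ := fun x y ↦ ‖DK (x, y)‖ₑ * (closedBall (0 : E3) ρ).indicator 1 y with hKdef
  have hKm : Measurable (uncurry K) := by
    refine hDKm.measurable.enorm.mul ?_
    exact (measurable_one.indicator measurableSet_closedBall).comp measurable_snd
  have hKle : ∀ x y, K x y ≤ k (x - y) := by
    intro x y
    by_cases hy : y ∈ closedBall (0 : E3) ρ
    · have hy' : ‖y‖ ≤ ρ := by rwa [mem_closedBall, dist_zero_right] at hy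
      simp only [hKdef, hk, indicator_of_mem hy, Pi.one_apply, mul_one]
      rw [← ofReal_norm]
      refine ENNReal.ofReal_le_ofReal ?_
      by_cases hz : x - y = 0
      · have h0 : DK (x, y) = 0 := by
          have hzi : (x - y) i = 0 := by rw [hz]; rfl
          simp only [hDK, hzi, zero_mul, zero_smul, zero_add]
          have hzj : (x - y) j = 0 := by rw [hz]; rfl
          simp [hzj]
        rw [h0, norm_zero]
        exact indicator_nonneg (fun z _ ↦ by
          have : 0 ≤ M := (abs_nonneg _).trans (hMabs 0)
          have : 0 ≤ M' := (norm_nonneg _).trans (hM' 0)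
          positivity) _
      · exact norm_fderiv_classicalKernel_le hη hR hMabs hM' hRρ hy' hz i j
    · simp only [hKdef, indicator_of_notMem hy, mul_zero]
      exact bot_le
  have hrow : ∀ᵐ x ∂(volume : Measure E3), ∫⁻ y, K x y * (1 : ℝ≥0∞) ^ (2 : ℝ) ≤ Ck * (1 : ℝ≥0∞) ^ (2 : ℝ) := by
    refine ae_of_all _ fun x ↦ ?_
    simp only [ENNReal.one_rpow, mul_one]
    calc ∫⁻ y, K x y ≤ ∫⁻ y, k (x - y) := lintegral_mono fun y ↦ hKle x y
      _ = Ck := by rw [hCk, lintegral_sub_left_eq_self k x]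
  have hcol : ∀ᵐ y ∂(volume : Measure E3), ∫⁻ x, K x y * (1 : ℝ≥0∞) ^ (2 : ℝ) ≤ Ck * (1 : ℝ≥0∞) ^ (2 : ℝ) := by
    refine ae_of_all _ fun y ↦ ?_
    simp only [ENNReal.one_rpow, mul_one]
    calc ∫⁻ x, K x y ≤ ∫⁻ x, k (x - y) := lintegral_mono fun x ↦ hKle x y
      _ = Ck := by rw [hCk, lintegral_sub_right_eq_self k y]
  have hschur := Literature.Analysis.SingularIntegrals.lintegral_rpow_lintegral_le_of_schur
    (μ := (volume : Measure E3)) (ν := (volume : Measure E3)) (p := 2) (q := 2) Real.HolderConjugate.two_two hKm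
    measurable_const measurable_const (ae_of_all _ fun _ ↦ one_ne_zero) (ae_of_all _ fun _ ↦ ENNReal.one_ne_top)
    hrow hcol (f := fun y ↦ ‖f y‖ₑ) hf.continuous.measurable.enorm
  refine le_trans (lintegral_mono fun x ↦ ?_) hschur
  refine ENNReal.rpow_le_rpow ?_ (by norm_num)
  rw [pd_bogovskiiS_eq_integral_kernelDeriv hη hR hf hfc i j m x]
  refine (enorm_integral_le_lintegral_enorm _).trans (lintegral_mono fun y ↦ ?_)
  rw [enorm_mul]
  by_cases hfy : f y = 0
  · simp [hfy]
  · have hy : y ∈ closedBall (0 : E3) ρ := by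
      rw [mem_closedBall, dist_zero_right]; exact hfρ y hfy
    simp only [hKdef, indicator_of_mem hy, Pi.one_apply, mul_one]
    refine mul_le_mul' ?_ le_rfl
    rw [Real.enorm_eq_ofReal_abs, ← ofReal_norm]
    exact ENNReal.ofReal_le_ofReal (abs_apply_e_le_opNorm (DK (x, y)) m)

end H1C

end MaoOhTao

end Literature.Geometry.Lorentzian

end
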